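import Summits.HodgeConjecture.HodgeConjecture.Theorems.Ring2HypothesesDescentAbsoluteExteriorStabilizerProducts
import Literature.AlgebraicGeometry.HodgeTheory.HodgeGroupSplitsNoTypeIVTimesCM
import HarnessLib

/-!
# Ring 2 — hypotheses layer, descent axis: PRODUCTS — THE PRICES OF THE DICTIONARY OVER SPLIT PAIRS: `G_P(B × C) ≤ G_Q(B × C)` from
# `G_P(B) ≤ G_Q(B)` and `G_P(C) ≤ G_Q(C)` when `G_Q(B × C)` splits, and back when `G_P(B × C)` splits; the `HC_AV` bracket
# `G¹_alg ≤ Hg` and the c1-price `G¹_AH ≤ Hg` are MULTIPLICATIVE over `A × C`, `A` without type-IV factor, `C` of CM type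

HONEST FRAMING (page 1, verbatim the cell's standing line): **research route conditional on HC_CM; not a corollary;
Q11.4-sentence-2 already refuted in dim ≥ 3.** Nothing in this file proves a case of the Hodge conjecture; nothing discharges the
binder of record b06 `Ring2.Hypotheses.AbsoluteHodgeImpliesAlgebraicAV` (OPEN); the binder table's numbers do not move. `HC_CM`,
`HC_AV` and row b06 are ABSENT from this file (the row's PRICE `G¹_alg ≤ G¹_AH` occurs as hypothesis and conclusion of §2 (c), never
asserted). Hodge ladder STAGE 3, `BINDER-OWNERS.md` row **b06**, seat `ring2-b06` (gen 87). Sequel of `…ExteriorStabilizerProducts`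
(`G_P(B × C) ≤ G_P(B) × G_P(C)`) — the product analogue of the powers files' TRANSFER `le_powSucc_iff` (gen 86) — and of the
Literature's `HodgeTheory/HodgeGroupSplitsNoTypeIVTimesCM` (this seat, same gen: `Hg(A × C) = Hg(A) × Hg(C)` Tannaka-free and
UNCONDITIONAL for `A` without simple factor of type IV and `C` of CM type — the Literature lane's discharged Lombardo span theorem run
through Moonen–Zarhin (3.1) `⟸`).

THE SETTING (as in the companions): class notions `P`, `Q`; `G_P(Y) := powClassStabilizer Y.X (P on the powers of Y)`; ADMISSIBLE = the
displayed `hS`/`hP`; "`G_Q(B × C)` SPLITS" = `∀ u v, ⋀•u ∈ G_Q(B) → ⋀•v ∈ G_Q(C) → ⋀•(u ⊕ v) ∈ G_Q(B × C)` (displayed; no definition).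

* §1 (namespace `StabilizerProducts`) `le_prod_of_le_of_le` — **`G_P ≤ G_Q` at `B` and at `C` ⟹ at `B × C`, when `G_Q(B × C)` splits**
  (`P` admissible: an element of `G_P(B × C)` is `⋀•(u ⊕ v)` with `⋀•u ∈ G_P(B) ≤ G_Q(B)`, `⋀•v ∈ G_P(C) ≤ G_Q(C)`);
  `le_of_le_prod_left/right` — **back: `G_P ≤ G_Q` at `B × C` ⟹ at `B` and at `C`, when `G_P(B × C)` splits** (`P`, `Q` admissible:
  `⋀•(g₁ ⊕ 𝟙) ∈ G_P(B × C) ≤ G_Q(B × C)`, and blocks are unique); `le_prod_iff`.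
* §2 instances (a) **THE `HC_AV` BRACKET `G¹_alg ≤ Hg` IS MULTIPLICATIVE OVER Hg-SPLIT PAIRS, FACT-FREE**
  (`algebraicStabilizer_le_hodgeGroup_prod_of_le_of_le`; companion §5 needed `HC` on all powers of both factors — here the group
  inclusions alone), hence **over `A × C` for `A` without type-IV factor and `C` of CM type with NO splitting hypothesis**
  (`algebraicStabilizer_le_hodgeGroup_prod_of_hasNoTypeIVFactor_of_isOfCMType`); (b) **THE c1-PRICE `G¹_AH ≤ Hg` (Deligne's "Hodge ⟹
  absolute Hodge" read on the groups) IS MULTIPLICATIVE** over Hg-split pairs and over no-type-IV × CM (mod c23 + c35 + (E) for the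
  admissibility of the absolute Hodge system); (c) the ROW'S PRICE `G¹_alg ≤ G¹_AH` is multiplicative over `G¹_AH`-split pairs
  (displayed hypothesis; fact-free otherwise).

HONEST COLUMN. No definition, no NEW named fact, no sorry; displayed facts c23 (`hZ`), c35 (`hN`), (E) (`hex`) in (b) only. As a
SLICE nothing is new; new are the transfers of the prices to products. (a) over no-type-IV × CM says: if `HC` holds on all powers of `A`
and on all powers of the CM variety `C` (the latter ⟸ `HC_CM`), then `G¹_alg(A × C) ≤ Hg(A × C)` — typer 2's bracket, which grants `HC` on
all powers of `A × C` only MODULO (P2) (`AlgebraicInvariantsPrincipleAV`); the unconditional `HC(A × C) ⟸ HC(A) ∧ HC_CM` of this sector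
is the Literature lane's (`NoTypeIVTimesCMProductSpan` §3), not claimed here. NOT obtained: splitting of `G¹_alg` / `G¹_AH` / `G¹_mot`
for any concrete pair (needs product-span hypotheses for those classes, false in general); anything deciding the row. PRESEARCH as in
the companions (Moonen–Zarhin §1/§3, Lombardo 3.4 via the lanes' files; certification by assembly, no novelty claimed). References
(bib keys): MoonenZarhin1999LowDim (§3 (3.1), (3.2)), Lombardo2016 (Lemma 3.4), Milne1999LefschetzClasses (§1 p. 643),
Andre1996Motifs (§4.6 (ii), §6.2–6.3), Deligne1982HodgeCycles (I §3, Thm. 2.11, §2 Ex. 2.1 (a)), CharlesSchnell2014Notes ((11.2.2)–(11.2.3)),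
FloccariFu2026 (§5).
-/

noncomputable section

-- every declaration of this problem lives in `Summit.HodgeConjecture.HodgeConjecture.…` (summit = sub-problem)
set_option linter.dupNamespace false

namespace Summit.HodgeConjecture.HodgeConjecture.Ring2.Hypotheses

open CategoryTheory AlgebraicGeometry MonoidalCategory CartesianMonoidalCategory
open Literature.AlgebraicGeometry Literature.AlgebraicGeometry.Motives
open Literature.AlgebraicGeometry.HodgeTheory
open Literature.AlgebraicTopology.SingularHomology
open Literature.AlgebraicGeometry.VanGeemen1994 (hodgeGroupOne mem_hodgeGroupOne_iff)
open Literature.AlgebraicGeometry.Milne1999 (specialLefschetzGroup centralizerGroup exteriorPullbackEquiv prodBlockDiagEquiv)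

/-! ## §1 Generic: prices over split pairs -/

namespace StabilizerProducts

variable {P Q : ∀ (_N : ℕ) (Y : SchemeOver ℂ) (p : ℕ), Set (complexBetti Y (2 * p))}

/-- Blocks are unique: `s ⊕ t = s' ⊕ t' ⟹ s = s'`. [cite: Milne1999LefschetzClasses, §1 p. 643] -/
private theorem left_eq_of_prodBlockDiagEquiv_eq {B C : AbelianVariety ℂ} {s s' : complexBetti B.X 1 ≃ₗ[ℂ] complexBetti B.X 1}
    {t t' : complexBetti C.X 1 ≃ₗ[ℂ] complexBetti C.X 1} (h : prodBlockDiagEquiv s t = prodBlockDiagEquiv s' t') : s = s' := by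
  refine LinearEquiv.ext fun b ↦ ?_
  rw [← Milne1999.prodRestrictFst_prodBlockDiagEquiv_apply s t b, ← Milne1999.prodRestrictFst_prodBlockDiagEquiv_apply s' t' b, h]

/-- Blocks are unique: `s ⊕ t = s' ⊕ t' ⟹ t = t'`. [cite: Milne1999LefschetzClasses, §1 p. 643] -/
private theorem right_eq_of_prodBlockDiagEquiv_eq {B C : AbelianVariety ℂ} {s s' : complexBetti B.X 1 ≃ₗ[ℂ] complexBetti B.X 1}
    {t t' : complexBetti C.X 1 ≃ₗ[ℂ] complexBetti C.X 1} (h : prodBlockDiagEquiv s t = prodBlockDiagEquiv s' t') : t = t' := by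
  refine LinearEquiv.ext fun c ↦ ?_
  rw [← Milne1999.prodRestrictSnd_prodBlockDiagEquiv_apply s t c, ← Milne1999.prodRestrictSnd_prodBlockDiagEquiv_apply s' t' c, h]

/-- `⋀•𝟙 = 𝟙` as a family. [cite: HatcherAT2002, §3.2 Example 3.16] -/
private theorem exteriorPullbackEquiv_one_family (Y : AbelianVariety ℂ) :
    (fun k ↦ exteriorPullbackEquiv (AbelianVariety.hasExteriorCohomologyH1_complexPoints Y)
      (1 : complexBetti Y.X 1 ≃ₗ[ℂ] complexBetti Y.X 1) k) = 1 := by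
  funext k
  refine LinearEquiv.toLinearMap_injective ?_
  rw [Milne1999.coe_exteriorPullbackEquiv]
  exact Milne1999.exteriorPullback_id _ k

section Up

variable (hSP : ∀ B : AbelianVariety ℂ,
    powClassStabilizer B.X (fun a p ↦ P (cartesianPowDim B.dim a) (cartesianPow B.X (a + 1)) p) ≤ specialLefschetzGroup B.dim B.X)
  (hPP : ∀ ⦃B B' : AbelianVariety ℂ⦄ (f : B ⟶ B') ⦃p : ℕ⦄ ⦃c : complexBetti B'.X (2 * p)⦄,
    c ∈ P B'.dim B'.X p → complexBetti.map f.hom.hom.hom (2 * p) c ∈ P B.dim B.X p)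
include hSP hPP

/-- **`G_P ≤ G_Q` at `B` and at `C` ⟹ `G_P(B × C) ≤ G_Q(B × C)`, when `G_Q(B × C)` splits** (`P` admissible; nothing is asked of `Q` but
the splitting): an element of `G_P(B × C)` is `⋀•(u ⊕ v)` with `⋀•u ∈ G_P(B)`, `⋀•v ∈ G_P(C)` (companion §2).
[cite: MoonenZarhin1999LowDim, §3 (3.1)] [cite: Milne1999LefschetzClasses, §1 p. 643] [cite: Andre1996Motifs, §4.6 (ii) (p. 24)] -/
theorem le_prod_of_le_of_le (B C : AbelianVariety ℂ)
    (hsplitQ : ∀ (u : complexBetti B.X 1 ≃ₗ[ℂ] complexBetti B.X 1) (v : complexBetti C.X 1 ≃ₗ[ℂ] complexBetti C.X 1),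
      (fun k ↦ exteriorPullbackEquiv (AbelianVariety.hasExteriorCohomologyH1_complexPoints B) u k) ∈
          powClassStabilizer B.X (fun a p ↦ Q (cartesianPowDim B.dim a) (cartesianPow B.X (a + 1)) p) →
        (fun k ↦ exteriorPullbackEquiv (AbelianVariety.hasExteriorCohomologyH1_complexPoints C) v k) ∈
          powClassStabilizer C.X (fun a p ↦ Q (cartesianPowDim C.dim a) (cartesianPow C.X (a + 1)) p) →
        (fun k ↦ exteriorPullbackEquiv (AbelianVariety.hasExteriorCohomologyH1_complexPoints (B.prod C)) (prodBlockDiagEquiv u v) k) ∈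
          powClassStabilizer (B.prod C).X (fun a p ↦ Q (cartesianPowDim (B.prod C).dim a) (cartesianPow (B.prod C).X (a + 1)) p))
    (hB : powClassStabilizer B.X (fun a p ↦ P (cartesianPowDim B.dim a) (cartesianPow B.X (a + 1)) p) ≤
      powClassStabilizer B.X (fun a p ↦ Q (cartesianPowDim B.dim a) (cartesianPow B.X (a + 1)) p))
    (hC : powClassStabilizer C.X (fun a p ↦ P (cartesianPowDim C.dim a) (cartesianPow C.X (a + 1)) p) ≤
      powClassStabilizer C.X (fun a p ↦ Q (cartesianPowDim C.dim a) (cartesianPow C.X (a + 1)) p)) :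
    powClassStabilizer (B.prod C).X (fun a p ↦ P (cartesianPowDim (B.prod C).dim a) (cartesianPow (B.prod C).X (a + 1)) p) ≤
      powClassStabilizer (B.prod C).X (fun a p ↦ Q (cartesianPowDim (B.prod C).dim a) (cartesianPow (B.prod C).X (a + 1)) p) := by
  intro g' hg'
  obtain ⟨u, v, hu, hv, rfl⟩ := exists_eq_prodBlockDiagEquiv hSP hPP B C hg'
  exact hsplitQ u v (hB hu) (hC hv)

end Up

section Down

variable (hSP : ∀ B : AbelianVariety ℂ,
    powClassStabilizer B.X (fun a p ↦ P (cartesianPowDim B.dim a) (cartesianPow B.X (a + 1)) p) ≤ specialLefschetzGroup B.dim B.X)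
  (hSQ : ∀ B : AbelianVariety ℂ,
    powClassStabilizer B.X (fun a p ↦ Q (cartesianPowDim B.dim a) (cartesianPow B.X (a + 1)) p) ≤ specialLefschetzGroup B.dim B.X)
  (hPQ : ∀ ⦃B B' : AbelianVariety ℂ⦄ (f : B ⟶ B') ⦃p : ℕ⦄ ⦃c : complexBetti B'.X (2 * p)⦄,
    c ∈ Q B'.dim B'.X p → complexBetti.map f.hom.hom.hom (2 * p) c ∈ Q B.dim B.X p)
include hSP hSQ hPQ

/-- **Back, first factor: `G_P(B × C) ≤ G_Q(B × C)` ⟹ `G_P(B) ≤ G_Q(B)`, when `G_P(B × C)` splits** (`P` satisfying (S), `Q` admissible):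
for `g ∈ G_P(B)`, `g = ⋀•(g₁)` and `⋀•(g₁ ⊕ 𝟙) ∈ G_P(B × C) ≤ G_Q(B × C)`, whose first block `⋀•g₁` lies in `G_Q(B)` (companion §2 for `Q`;
blocks are unique). [cite: MoonenZarhin1999LowDim, §3 (3.1)] [cite: Milne1999LefschetzClasses, §1 p. 643 and Thm. 4.4] -/
theorem le_of_le_prod_left (B C : AbelianVariety ℂ)
    (hsplitP : ∀ (u : complexBetti B.X 1 ≃ₗ[ℂ] complexBetti B.X 1) (v : complexBetti C.X 1 ≃ₗ[ℂ] complexBetti C.X 1),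
      (fun k ↦ exteriorPullbackEquiv (AbelianVariety.hasExteriorCohomologyH1_complexPoints B) u k) ∈
          powClassStabilizer B.X (fun a p ↦ P (cartesianPowDim B.dim a) (cartesianPow B.X (a + 1)) p) →
        (fun k ↦ exteriorPullbackEquiv (AbelianVariety.hasExteriorCohomologyH1_complexPoints C) v k) ∈
          powClassStabilizer C.X (fun a p ↦ P (cartesianPowDim C.dim a) (cartesianPow C.X (a + 1)) p) →
        (fun k ↦ exteriorPullbackEquiv (AbelianVariety.hasExteriorCohomologyH1_complexPoints (B.prod C)) (prodBlockDiagEquiv u v) k) ∈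
          powClassStabilizer (B.prod C).X (fun a p ↦ P (cartesianPowDim (B.prod C).dim a) (cartesianPow (B.prod C).X (a + 1)) p))
    (hBC : powClassStabilizer (B.prod C).X (fun a p ↦ P (cartesianPowDim (B.prod C).dim a) (cartesianPow (B.prod C).X (a + 1)) p) ≤
      powClassStabilizer (B.prod C).X (fun a p ↦ Q (cartesianPowDim (B.prod C).dim a) (cartesianPow (B.prod C).X (a + 1)) p)) :
    powClassStabilizer B.X (fun a p ↦ P (cartesianPowDim B.dim a) (cartesianPow B.X (a + 1)) p) ≤
      powClassStabilizer B.X (fun a p ↦ Q (cartesianPowDim B.dim a) (cartesianPow B.X (a + 1)) p) := by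
  intro g hg
  have hgeq := (StabilizerPowers.eq_exteriorPullbackEquiv_and_mem_centralizerGroup (hSP B) hg).1
  have h1 : (fun k ↦ exteriorPullbackEquiv (AbelianVariety.hasExteriorCohomologyH1_complexPoints C)
      (1 : complexBetti C.X 1 ≃ₗ[ℂ] complexBetti C.X 1) k) ∈
        powClassStabilizer C.X (fun a p ↦ P (cartesianPowDim C.dim a) (cartesianPow C.X (a + 1)) p) := by
    rw [exteriorPullbackEquiv_one_family]; exact one_mem _
  have hprod := hBC (hsplitP (g 1) 1 (hgeq ▸ hg) h1)
  obtain ⟨u', v', hu', -, e⟩ := exists_eq_prodBlockDiagEquiv hSQ hPQ B C hprod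
  have e1 : prodBlockDiagEquiv (g 1) 1 = prodBlockDiagEquiv u' v' := by
    have e2 := congrFun e 1
    rwa [Milne1999.exteriorPullbackEquiv_one_eq, Milne1999.exteriorPullbackEquiv_one_eq] at e2
  rw [hgeq, left_eq_of_prodBlockDiagEquiv_eq e1]
  exact hu'

/-- **Back, second factor: `G_P(B × C) ≤ G_Q(B × C)` ⟹ `G_P(C) ≤ G_Q(C)`, when `G_P(B × C)` splits.**
[cite: MoonenZarhin1999LowDim, §3 (3.1)] [cite: Milne1999LefschetzClasses, §1 p. 643 and Thm. 4.4] -/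
theorem le_of_le_prod_right (B C : AbelianVariety ℂ)
    (hsplitP : ∀ (u : complexBetti B.X 1 ≃ₗ[ℂ] complexBetti B.X 1) (v : complexBetti C.X 1 ≃ₗ[ℂ] complexBetti C.X 1),
      (fun k ↦ exteriorPullbackEquiv (AbelianVariety.hasExteriorCohomologyH1_complexPoints B) u k) ∈
          powClassStabilizer B.X (fun a p ↦ P (cartesianPowDim B.dim a) (cartesianPow B.X (a + 1)) p) →
        (fun k ↦ exteriorPullbackEquiv (AbelianVariety.hasExteriorCohomologyH1_complexPoints C) v k) ∈
          powClassStabilizer C.X (fun a p ↦ P (cartesianPowDim C.dim a) (cartesianPow C.X (a + 1)) p) →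
        (fun k ↦ exteriorPullbackEquiv (AbelianVariety.hasExteriorCohomologyH1_complexPoints (B.prod C)) (prodBlockDiagEquiv u v) k) ∈
          powClassStabilizer (B.prod C).X (fun a p ↦ P (cartesianPowDim (B.prod C).dim a) (cartesianPow (B.prod C).X (a + 1)) p))
    (hBC : powClassStabilizer (B.prod C).X (fun a p ↦ P (cartesianPowDim (B.prod C).dim a) (cartesianPow (B.prod C).X (a + 1)) p) ≤
      powClassStabilizer (B.prod C).X (fun a p ↦ Q (cartesianPowDim (B.prod C).dim a) (cartesianPow (B.prod C).X (a + 1)) p)) :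
    powClassStabilizer C.X (fun a p ↦ P (cartesianPowDim C.dim a) (cartesianPow C.X (a + 1)) p) ≤
      powClassStabilizer C.X (fun a p ↦ Q (cartesianPowDim C.dim a) (cartesianPow C.X (a + 1)) p) := by
  intro k hk
  have hkeq := (StabilizerPowers.eq_exteriorPullbackEquiv_and_mem_centralizerGroup (hSP C) hk).1
  have h1 : (fun i ↦ exteriorPullbackEquiv (AbelianVariety.hasExteriorCohomologyH1_complexPoints B)
      (1 : complexBetti B.X 1 ≃ₗ[ℂ] complexBetti B.X 1) i) ∈
        powClassStabilizer B.X (fun a p ↦ P (cartesianPowDim B.dim a) (cartesianPow B.X (a + 1)) p) := by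
    rw [exteriorPullbackEquiv_one_family]; exact one_mem _
  have hprod := hBC (hsplitP 1 (k 1) h1 (hkeq ▸ hk))
  obtain ⟨u', v', -, hv', e⟩ := exists_eq_prodBlockDiagEquiv hSQ hPQ B C hprod
  have e1 : prodBlockDiagEquiv 1 (k 1) = prodBlockDiagEquiv u' v' := by
    have e2 := congrFun e 1
    rwa [Milne1999.exteriorPullbackEquiv_one_eq, Milne1999.exteriorPullbackEquiv_one_eq] at e2
  rw [hkeq, right_eq_of_prodBlockDiagEquiv_eq e1]
  exact hv'

end Down

end StabilizerProducts

/-! ## §2 Instances: the `HC_AV` bracket, the c1-price and the row's price over split pairs and over no-type-IV × CM -/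

section Instances

variable (B C : AbelianVariety ℂ)

/-- **(a) THE `HC_AV` BRACKET IS MULTIPLICATIVE OVER Hg-SPLIT PAIRS, FACT-FREE**: if `⋀•(u ⊕ v) ∈ Hg(B × C)` for all `u ∈ Hg(B)|_{H¹}`,
`v ∈ Hg(C)|_{H¹}`, then `G¹_alg(B) ≤ Hg(B)` and `G¹_alg(C) ≤ Hg(C)` give `G¹_alg(B × C) ≤ Hg(B × C)` — no `HC` hypothesis (companion §5 went
through `HC` on all powers). [cite: MoonenZarhin1999LowDim, §3 (3.1)] [cite: Andre1996Motifs, §6.3 (p. 31)] [cite: FloccariFu2026, §5 (p. 13)] -/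
theorem algebraicStabilizer_le_hodgeGroup_prod_of_le_of_le
    (hsplit : ∀ u ∈ hodgeGroupOne B.dim B.X, ∀ v ∈ hodgeGroupOne C.dim C.X,
      (fun k ↦ exteriorPullbackEquiv (AbelianVariety.hasExteriorCohomologyH1_complexPoints (B.prod C)) (prodBlockDiagEquiv u v) k) ∈
        hodgeGroup (B.prod C).dim (B.prod C).X)
    (hB : algebraicStabilizer B.X ≤ hodgeGroup B.dim B.X) (hC : algebraicStabilizer C.X ≤ hodgeGroup C.dim C.X) :
    algebraicStabilizer (B.prod C).X ≤ hodgeGroup (B.prod C).dim (B.prod C).X := by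
  have h := @StabilizerProducts.le_prod_of_le_of_le (fun _ Y p ↦ (algebraicClasses Y p : Set _))
    (fun N Y p ↦ {c : complexBetti Y (2 * p) | IsRationalClass c ∧ IsOfHodgeType N Y (2 * p) p p c})
    algebraicStabilizer_admissibleS algebraicClasses_admissibleP B C
    (fun u v hu hv ↦ hsplit u (mem_hodgeGroupOne_iff.2 ⟨_, hu, Milne1999.exteriorPullbackEquiv_one_eq _ _⟩) v
      (mem_hodgeGroupOne_iff.2 ⟨_, hv, Milne1999.exteriorPullbackEquiv_one_eq _ _⟩))
  exact h hB hC

/-- **(a′) THE `HC_AV` BRACKET IS MULTIPLICATIVE OVER `A × C`, `A` WITHOUT SIMPLE FACTOR OF TYPE IV, `C` OF CM TYPE — no splitting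
hypothesis** (the splitting is the Literature's UNCONDITIONAL `forall_prodBlockDiagEquiv_mem_hodgeGroup_of_hasNoTypeIVFactor_of_isOfCMType`,
Lombardo 3.4 / Moonen–Zarhin (3.2)(2) Tannaka-free). With typer 2's pricing: `HC` on all powers of `A` and of `C` ⟹ the two hypotheses
(fact-free), and the conclusion ⟹ `HC` on all powers of `A × C` modulo (P2). [cite: Lombardo2016, Lemma 3.4 (p. 1229)]
[cite: MoonenZarhin1999LowDim, §3 (3.2)] [cite: Andre1996Motifs, §6.3 (p. 31)] -/
theorem algebraicStabilizer_le_hodgeGroup_prod_of_hasNoTypeIVFactor_of_isOfCMType (hB4 : HasNoTypeIVFactor B) (hCcm : Milne1999.IsOfCMType C)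
    (hB : algebraicStabilizer B.X ≤ hodgeGroup B.dim B.X) (hC : algebraicStabilizer C.X ≤ hodgeGroup C.dim C.X) :
    algebraicStabilizer (B.prod C).X ≤ hodgeGroup (B.prod C).dim (B.prod C).X :=
  algebraicStabilizer_le_hodgeGroup_prod_of_le_of_le B C
    (forall_prodBlockDiagEquiv_mem_hodgeGroup_of_hasNoTypeIVFactor_of_isOfCMType B C hB4 hCcm) hB hC

/-- **(b) THE c1-PRICE `G¹_AH ≤ Hg` IS MULTIPLICATIVE OVER Hg-SPLIT PAIRS** (mod c23 = V-B3 `hZ`, c35 = (N) `hN`, (E) `hex` for the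
admissibility of the absolute Hodge system): Deligne's «Hodge ⟹ absolute Hodge» read on the Tannaka-free groups of `B` and `C` gives it on
`B × C` when `Hg(B × C)` splits. [cite: Deligne1982HodgeCycles, Thm. 2.11 and I §3] [cite: MoonenZarhin1999LowDim, §3 (3.1)]
[cite: CharlesSchnell2014Notes, §11.2.2 (11.2.2)–(11.2.3)] -/
theorem absoluteHodgeStabilizer_le_hodgeGroup_prod_of_le_of_le (hZ : deligne1982_cycleClass_absoluteHodge) (hN : chartConjugation_canonical)
    (hex : ∀ ⦃n : ℕ⦄ ⦃X : SchemeOver ℂ⦄, IsSmoothProjective n X →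
      ∀ (σ : ℂ ≃+* ℂ) (p : ℕ) (c : complexBetti X (2 * p)), ∃ s, IsConjugateClass σ X (2 * p) c s)
    (hsplit : ∀ u ∈ hodgeGroupOne B.dim B.X, ∀ v ∈ hodgeGroupOne C.dim C.X,
      (fun k ↦ exteriorPullbackEquiv (AbelianVariety.hasExteriorCohomologyH1_complexPoints (B.prod C)) (prodBlockDiagEquiv u v) k) ∈
        hodgeGroup (B.prod C).dim (B.prod C).X)
    (hB : powClassStabilizer B.X (fun a p ↦ {c : complexBetti (cartesianPow B.X (a + 1)) (2 * p) |
        IsAbsoluteHodgeClass (cartesianPowDim B.dim a) (cartesianPow B.X (a + 1)) p c}) ≤ hodgeGroup B.dim B.X)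
    (hC : powClassStabilizer C.X (fun a p ↦ {c : complexBetti (cartesianPow C.X (a + 1)) (2 * p) |
        IsAbsoluteHodgeClass (cartesianPowDim C.dim a) (cartesianPow C.X (a + 1)) p c}) ≤ hodgeGroup C.dim C.X) :
    powClassStabilizer (B.prod C).X (fun a p ↦ {c : complexBetti (cartesianPow (B.prod C).X (a + 1)) (2 * p) |
        IsAbsoluteHodgeClass (cartesianPowDim (B.prod C).dim a) (cartesianPow (B.prod C).X (a + 1)) p c}) ≤
      hodgeGroup (B.prod C).dim (B.prod C).X := by
  have h := @StabilizerProducts.le_prod_of_le_of_le (fun N Y p ↦ {c : complexBetti Y (2 * p) | IsAbsoluteHodgeClass N Y p c})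
    (fun N Y p ↦ {c : complexBetti Y (2 * p) | IsRationalClass c ∧ IsOfHodgeType N Y (2 * p) p p c})
    (absoluteHodgeStabilizer_admissibleS hZ) (absoluteHodgeClasses_admissibleP hN hex) B C
    (fun u v hu hv ↦ hsplit u (mem_hodgeGroupOne_iff.2 ⟨_, hu, Milne1999.exteriorPullbackEquiv_one_eq _ _⟩) v
      (mem_hodgeGroupOne_iff.2 ⟨_, hv, Milne1999.exteriorPullbackEquiv_one_eq _ _⟩))
  exact h hB hC

/-- **(b′) the c1-price over `A × C`, `A` without type-IV factor, `C` of CM type** (no splitting hypothesis; mod c23 + c35 + (E)).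
[cite: Deligne1982HodgeCycles, Thm. 2.11] [cite: Lombardo2016, Lemma 3.4 (p. 1229)] [cite: MoonenZarhin1999LowDim, §3 (3.2)] -/
theorem absoluteHodgeStabilizer_le_hodgeGroup_prod_of_hasNoTypeIVFactor_of_isOfCMType (hZ : deligne1982_cycleClass_absoluteHodge)
    (hN : chartConjugation_canonical)
    (hex : ∀ ⦃n : ℕ⦄ ⦃X : SchemeOver ℂ⦄, IsSmoothProjective n X →
      ∀ (σ : ℂ ≃+* ℂ) (p : ℕ) (c : complexBetti X (2 * p)), ∃ s, IsConjugateClass σ X (2 * p) c s)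
    (hB4 : HasNoTypeIVFactor B) (hCcm : Milne1999.IsOfCMType C)
    (hB : powClassStabilizer B.X (fun a p ↦ {c : complexBetti (cartesianPow B.X (a + 1)) (2 * p) |
        IsAbsoluteHodgeClass (cartesianPowDim B.dim a) (cartesianPow B.X (a + 1)) p c}) ≤ hodgeGroup B.dim B.X)
    (hC : powClassStabilizer C.X (fun a p ↦ {c : complexBetti (cartesianPow C.X (a + 1)) (2 * p) |
        IsAbsoluteHodgeClass (cartesianPowDim C.dim a) (cartesianPow C.X (a + 1)) p c}) ≤ hodgeGroup C.dim C.X) :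
    powClassStabilizer (B.prod C).X (fun a p ↦ {c : complexBetti (cartesianPow (B.prod C).X (a + 1)) (2 * p) |
        IsAbsoluteHodgeClass (cartesianPowDim (B.prod C).dim a) (cartesianPow (B.prod C).X (a + 1)) p c}) ≤
      hodgeGroup (B.prod C).dim (B.prod C).X :=
  absoluteHodgeStabilizer_le_hodgeGroup_prod_of_le_of_le B C hZ hN hex
    (forall_prodBlockDiagEquiv_mem_hodgeGroup_of_hasNoTypeIVFactor_of_isOfCMType B C hB4 hCcm) hB hC

/-- **(c) THE ROW'S PRICE `G¹_alg ≤ G¹_AH` IS MULTIPLICATIVE OVER `G¹_AH`-SPLIT PAIRS** (splitting of the absolute Hodge stabiliser displayed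
as the hypothesis `hsplitAH`; FACT-FREE otherwise — only the algebraic system needs to be admissible here).
[cite: Deligne1982HodgeCycles, I §3 Thm. 3.8] [cite: MoonenZarhin1999LowDim, §3 (3.1)] [cite: Andre1996Motifs, §4.6 (ii) (p. 24)] -/
theorem algebraicStabilizer_le_absoluteHodgeStabilizer_prod_of_le_of_le
    (hsplitAH : ∀ (u : complexBetti B.X 1 ≃ₗ[ℂ] complexBetti B.X 1) (v : complexBetti C.X 1 ≃ₗ[ℂ] complexBetti C.X 1),
      (fun k ↦ exteriorPullbackEquiv (AbelianVariety.hasExteriorCohomologyH1_complexPoints B) u k) ∈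
          powClassStabilizer B.X (fun a p ↦ {c : complexBetti (cartesianPow B.X (a + 1)) (2 * p) |
            IsAbsoluteHodgeClass (cartesianPowDim B.dim a) (cartesianPow B.X (a + 1)) p c}) →
        (fun k ↦ exteriorPullbackEquiv (AbelianVariety.hasExteriorCohomologyH1_complexPoints C) v k) ∈
          powClassStabilizer C.X (fun a p ↦ {c : complexBetti (cartesianPow C.X (a + 1)) (2 * p) |
            IsAbsoluteHodgeClass (cartesianPowDim C.dim a) (cartesianPow C.X (a + 1)) p c}) →
        (fun k ↦ exteriorPullbackEquiv (AbelianVariety.hasExteriorCohomologyH1_complexPoints (B.prod C)) (prodBlockDiagEquiv u v) k) ∈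
          powClassStabilizer (B.prod C).X (fun a p ↦ {c : complexBetti (cartesianPow (B.prod C).X (a + 1)) (2 * p) |
            IsAbsoluteHodgeClass (cartesianPowDim (B.prod C).dim a) (cartesianPow (B.prod C).X (a + 1)) p c}))
    (hB : algebraicStabilizer B.X ≤ powClassStabilizer B.X (fun a p ↦ {c : complexBetti (cartesianPow B.X (a + 1)) (2 * p) |
        IsAbsoluteHodgeClass (cartesianPowDim B.dim a) (cartesianPow B.X (a + 1)) p c}))
    (hC : algebraicStabilizer C.X ≤ powClassStabilizer C.X (fun a p ↦ {c : complexBetti (cartesianPow C.X (a + 1)) (2 * p) |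
        IsAbsoluteHodgeClass (cartesianPowDim C.dim a) (cartesianPow C.X (a + 1)) p c})) :
    algebraicStabilizer (B.prod C).X ≤ powClassStabilizer (B.prod C).X (fun a p ↦ {c : complexBetti (cartesianPow (B.prod C).X (a + 1)) (2 * p) |
        IsAbsoluteHodgeClass (cartesianPowDim (B.prod C).dim a) (cartesianPow (B.prod C).X (a + 1)) p c}) := by
  have h := @StabilizerProducts.le_prod_of_le_of_le (fun _ Y p ↦ (algebraicClasses Y p : Set _))
    (fun N Y p ↦ {c : complexBetti Y (2 * p) | IsAbsoluteHodgeClass N Y p c})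
    algebraicStabilizer_admissibleS algebraicClasses_admissibleP B C hsplitAH
  exact h hB hC

end Instances

end Summit.HodgeConjecture.HodgeConjecture.Ring2.Hypotheses

end
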